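import Summits.HubbardSuperconductivity.HubbardSuperconductivity.Theses.FunctionFieldCertificate
import Summits.HubbardSuperconductivity.HubbardSuperconductivity.Theorems.FunctionFieldCertificateMesoscopicPairOrderSplit
import HarnessLib

/-!
# Crux `MesoscopicPairOrder` (stmt-HubbardSuperconductivity-7331), line `pointwise_split` —
# skeleton (lead c6, reshaped 2026-08-17: the glue is now the TREE theorem
# `Theorems.FunctionFieldCertificate.mesoscopicPairOrder_of_subs`, p137259)

Route `FunctionFieldCertificate`, crux 2 (pole-free half): at one `(U, δ)` a margin
`m R² ≤ T_R(ψ)/L²` for the Fejér-box pair functional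
`T_R(ψ) = Σ_{x,y} Πᵢ (1 - |(y - x)ᵢ|_L/R)₊ Re⟨P_x ψ, P_y ψ⟩`, `P_x = localPair dWaveFormFactor L x`, at
ARBITRARILY LARGE scales `R`, in every normalised `(N_L, S^z = 0)`-sector ground state of
`hubbardTorus 2 L 1 U` on all large even tori. The crux is open physics and is NOT settled here.

Registered stubs (2): `stub_goldstonePairProfile` (A), `stub_leakBeatingBlockPairSeed` (B, LOAD-BEARING);
composition `MesoscopicPairOrder_of : MesoscopicPairOrder` from the two stubs BY NAME through the landed,
sorry-free glue `mesoscopicPairOrder_of_subs : (A) → (B) → MesoscopicPairOrder`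
(`Theorems/FunctionFieldCertificateMesoscopicPairOrderSplit.lean`, p137259; it is also the `--glue-by`
theorem of the planner's route split `MesoscopicPairOrder ⇐ GoldstonePairProfile ∧ LeakBeatingBlockPairSeed`,
children.json on the item). Budget-free forms of (B): `Theorems/FunctionFieldCertificateMesoscopicPairOrderSeedForms.lean`
(`leakBeatingBlockPairSeed_iff_superlinear`: (B) ⟺ ∃(U,δ) ∀C ∃R₀>0 ∃L₀ ∀ even L ≥ L₀ ∀ unit sector GS ψ:
`C·R₀ ≤ T_{R₀}(ψ)/L²` — super-linear block pair order; `superlinear_iff_blochCorrelation`: Bloch GS and the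
pair correlation function suffice). Line card: `Lines/pointwise_split.md`; census: `STRATEGY-CENSUS.md`.

* (A) **Goldstone pair profile** — at every `(U, δ)`, every normalised sector ground state of every
  large even torus has a POINTWISE infrared profile of its `d`-wave pair structure factor off the zero
  mode, `S_ψ(m) ≤ S + A/|q_m|` for all `m ≠ 0`. Implies the Σ-form pole half `WindowInfraredBound`
  (stmt-1089; tree `windowInfraredBound_of_goldstonePairProfile`). OPEN (no RP-free `T = 0` infrared
  bound for any quantum lattice model); the engines are those of stmt-1089.
* (B) **Leak-beating block pair seed** — at SOME `(U, δ)`: for every background budget `(S, A)`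
  there are ONE block scale `R₀ > 0`, a window radius `ε > 0` and a margin `m₀` beating the budget's
  leak, `32 ε (S ε + A) + (S + A/ε)/R₀² < m₀`, such that the crux body holds AT THE SINGLE SCALE `R₀`.
  A consequence of the crux (tree `leakBeatingBlockPairSeed_of_mesoscopicPairOrder`); carries all the
  U(1)-breaking content (pair quasi-order with exponent `η < 1` at a sequence of scales); OPEN, no engine.

Sources: Kennedy–Lieb–Shastry, PRL 61 (1988) 2582 [KLS1988PRL]; Dyson–Lieb–Simon (1978) Thms 3.1–4.2
[DysonLiebSimon1978]; Pitaevskii–Stringari (1991) [PitaevskiiStringari1991]. No definition is introduced.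
-/

noncomputable section

-- the summit namespace repeats the problem name by design (D-0017)
set_option linter.dupNamespace false

namespace Summit.HubbardSuperconductivity.HubbardSuperconductivity.Cruxes.MesoscopicPairOrder.PointwiseSplit

open Matrix Finset Filter
open Literature.Probability.LatticeModels Literature.MathematicalPhysics.QuantumLattice
open Summit.HubbardSuperconductivity.HubbardSuperconductivity.Theses.FunctionFieldCertificate
open Summit.HubbardSuperconductivity.HubbardSuperconductivity.Theorems.FunctionFieldCertificate
open scoped ComplexOrder ComplexConjugate


/-! ### The two stubs -/

/-- **Stub (A) `stub_goldstonePairProfile`** — GOLDSTONE PAIR PROFILE (the pole half, POINTWISE). At every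
`U > 0`, `δ ∈ (0, 1/2)` there are `S, A ≥ 0` and `L₀` such that every normalised `(N_L, 0)`-sector ground
state `ψ` of `hubbardTorus 2 L 1 U`, `L ≥ L₀` even, has `S_ψ(m) ≤ S + A/|q_m|` for every momentum label
`m ≠ 0` (`S_ψ = pairStructureFactor dWaveFormFactor L ψ`, `|q_m| = √(momentumNormSq L m)`): flat normal
background plus a Goldstone `1/|q|`, constants pointwise in `(U, δ)`. Implies the route's Σ-form pole
half `WindowInfraredBound` (stmt-1089; `windowInfraredBound_of_goldstonePairProfile` below). OPEN:
no reflection-positivity-free `T = 0` infrared bound is known for any quantum lattice model. -/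
theorem stub_goldstonePairProfile :
    ∀ U : ℝ, 0 < U → ∀ δ ∈ Set.Ioo (0:ℝ) (1 / 2), ∃ S A : ℝ, 0 ≤ S ∧ 0 ≤ A ∧ ∃ L₀ : ℕ,
      ∀ (L : ℕ) [NeZero L], L₀ ≤ L → Even L →
        ∀ ψ : Fock (Orb (FermionTorus 2 L)), star ψ ⬝ᵥ ψ = 1 →
          IsGroundStateInSector (hubbardTorus 2 L 1 U) (2 * ⌊(1 - δ) * (L : ℝ) ^ 2 / 2⌋₊) 0 ψ →
            ∀ m : TorusSite 2 L, m ≠ 0 →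
              pairStructureFactor dWaveFormFactor L ψ m ≤ S + A / Real.sqrt (momentumNormSq L m) := by
  sorry

/-- **Stub (B) `stub_leakBeatingBlockPairSeed`** (LOAD-BEARING) — the crux AT ONE SCALE. At some `U > 0`,
`δ ∈ (0, 1/2)`: for every background budget `S, A ≥ 0` there are ONE block scale `R₀ > 0`, a window
radius `ε > 0`, a margin `m₀` with `32 ε (S ε + A) + (S + A/ε)/R₀² < m₀`, and `L₀`, such that every
normalised sector ground state of every even `L ≥ L₀` has `m₀ R₀² ≤ T_{R₀}(ψ)/L²` (the crux body verbatim
at `R := R₀`). A CONSEQUENCE of the crux (`leakBeatingBlockPairSeed_of_mesoscopicPairOrder` below), not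
a restatement: no uniform margin at arbitrarily large scales is asked (qualitatively: the optimal
block-order margin decays slower than `1/R`); the `R → ∞` passage is charged to stub (A) by the pointwise
one-scale closure. OPEN (d-wave pair coherence at range `R₀ ~ 10²` in every sector ground state). -/
theorem stub_leakBeatingBlockPairSeed :
    ∃ U : ℝ, 0 < U ∧ ∃ δ ∈ Set.Ioo (0:ℝ) (1 / 2), ∀ S A : ℝ, 0 ≤ S → 0 ≤ A →
      ∃ (R₀ : ℕ) (ε m₀ : ℝ), 0 < R₀ ∧ 0 < ε ∧
        32 * ε * (S * ε + A) + (S + A / ε) / (R₀ : ℝ) ^ 2 < m₀ ∧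
        ∃ L₀ : ℕ, ∀ (L : ℕ) [NeZero L], L₀ ≤ L → Even L →
          ∀ ψ : Fock (Orb (FermionTorus 2 L)), star ψ ⬝ᵥ ψ = 1 →
            IsGroundStateInSector (hubbardTorus 2 L 1 U) (2 * ⌊(1 - δ) * (L : ℝ) ^ 2 / 2⌋₊) 0 ψ →
              m₀ * (R₀ : ℝ) ^ 2 ≤ (∑ x : Fin 2 → ZMod L, ∑ y : Fin 2 → ZMod L,
                (∏ i : Fin 2, max 0 (1 - |(((y i - x i).valMinAbs : ℤ) : ℝ)| / (R₀ : ℝ))) *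
                  (star (Matrix.mulVec (localPair dWaveFormFactor L x) ψ) ⬝ᵥ
                    Matrix.mulVec (localPair dWaveFormFactor L y) ψ).re) / (L : ℝ) ^ 2 := by
  sorry

/-! ### Composition: the crux modulo the two registered stubs -/

/-- **The line closes the crux modulo its stubs**: `MesoscopicPairOrder` from `stub_goldstonePairProfile`
(A) and `stub_leakBeatingBlockPairSeed` (B) through the sorry-free glue `mesoscopicPairOrder_of_subs`.
[folklore] -/
theorem MesoscopicPairOrder_of : MesoscopicPairOrder :=
  mesoscopicPairOrder_of_subs stub_goldstonePairProfile stub_leakBeatingBlockPairSeed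

end Summit.HubbardSuperconductivity.HubbardSuperconductivity.Cruxes.MesoscopicPairOrder.PointwiseSplit
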